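import Summits.ValiantsHypothesis.ValiantsHypothesis.Theorems.FifoMatchingNNDivisionHardShadowConstReadTwinPin

/-!
(PART 6 of 7 of the port — part 6 — §5e the fibre form (`TwinPCMOnTop`, ★★★ `pin_twin_pattern_block`, ★★★★★ `sTopFibre_decided`) + §5f `coordTop_decided`; split for the 400-line cap; texts verbatim by name, docstrings added to helpers.)
# SHADOW-CONSTANT READ / TWIN ROWS — decided classes of the located law of record C′ = `ExactPencilLaw`

Theorems-side port (staged by the author val-idea-41 g3; press as `Theorems/FifoMatchingNNDivisionHardShadowConstReadTwinFibre.lean`,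
`--kind proof --supports stmt-ValiantsHypothesis-21181 --as helper`) of the crux workfile `Cruxes/NNDivisionHard/ShadowConstRead41.lean`
REV 10 @72ea85f2ab68 (sha16 a021d0dfd0d83740, 1482 l., farm rc 0 / 0 sorries / 0 warnings; critic of record val-idea-crit-9 g2: WAVE-6
KEEP/KILL LIST 2026-08-29T00:50:44Z «41 g3 … `ShadowConstRead41` r1→r6 (★★★ `exactTilted_law_on_offDiagConst`, ★★★
`exactTilted_body_of_partialCommonMax`, `offDiagConst_decided`, ★★★★ `twinBlind_decided` / `interSpan_decided` / `blocks_decided` /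
`twinPCM_decided`)» KEPT; revs 7–10 (§5c–§5f) filed after the list's 00:30Z cut, graded in the wave-7 ledger).  Namespace
`Summit.ValiantsHypothesis.ValiantsHypothesis.Theorems.FifoMatching.ShadowConstRead` (parallel to `…LocatedRows`, whose frame — `T`, `RowFamily`, `three_pow_le_of_block`,
`hCOR`, `exactTilted`, `ExactPencilLaw`, `concl_of_lawBody`, `T_lt_of_block'`, `two_pow_half_mul_le` — is used BY NAME).

CONTENT: typed DECIDED CLASSES of the located law C′ (`exactTilted.Law`) in the tree's flat socket
`HasEFOfSize (corPolytope n + convexHull ℝ (Set.range q)) r → T c n < r`: shadow-constant / diagonal passengers (anchored star–clique tilt),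
partial-common-maximiser lists (junk-tolerant Kaibel–Weltge count), twin-blind / twin-PCM lists (antipodal twin rows; every span of 38 g2's
interaction matrices, so `Q_II`), and the twin transfer: a unique top — or a PCM on the top fibre — of ONE entrywise-nonnegative `S × S` pin.

HONEST LABEL: support theorems about the located LAW C′ on CLASSES of passengers, for an OPEN crux; `ExactPencilLaw` (C′), COR-VIRTUAL,
21181 `NNDivisionHard` are OPEN.  VP ≠ VNP is NOT proved here or anywhere in this tree.
-/

set_option autoImplicit false

-- the mandated summit-side namespace repeats a component by design (single-problem summit)
set_option linter.dupNamespace false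

noncomputable section

namespace Summit.ValiantsHypothesis.ValiantsHypothesis.Theorems.FifoMatching.ShadowConstRead

open Matrix Finset
open Literature.Barriers.PneNP (HasEFOfSize three_pow_le_card_mul_two_pow_of_cover_univ)
open Literature.Combinatorics.Optimization.FixedSizePsdRank (Cube bvec flat vecOuter corPolytope flat_dotProduct_vecOuter
  flat_dotProduct_le_of_mem_corPolytope)
open Summit.ValiantsHypothesis.ValiantsHypothesis.Theorems.FifoMatching.XcDivision
  (udInd udPt udRow udMat udInd_apply udInd_sq udInd_inter ud_data udRow_dotProduct_flat_diagonal flat_dotProduct_flat)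
open Summit.ValiantsHypothesis.ValiantsHypothesis.Theorems.FifoMatching.GridCorShadow (four_T_lt_two_pow)
open Summit.ValiantsHypothesis.ValiantsHypothesis.Theorems.FifoMatching.LocatedRows
  (T RowFamily three_pow_le_of_block two_pow_half_mul_le T_lt_of_block' hCOR le_hCOR exists_eq_hCOR flat_le_hCOR exactTilted ExactPencilLaw
    concl_of_lawBody CorVirtualHardN corVirtualHardN_of_exactPencilLaw sum_mul_udInd flat_dotProduct_udPt_eq flat_sub' flat_add' flat_smul')
open scoped Pointwise

section Part6
variable {k n : ℕ}

/-! §1 THE FRAME is the tree's, BY NAME: `T`, `RowFamily`, `three_pow_le_of_block`, `hCOR`, `le_hCOR`, `exists_eq_hCOR`, `flat_le_hCOR`,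
`exactTilted`, `ExactPencilLaw`, `concl_of_lawBody` (`…RowFamilies` / `…LocatedRowsColumnCoupled`), `two_pow_half_mul_le` (`…PairPencil`),
`T_lt_of_block'` (`…PinExposed`), `sum_mul_udInd` / `flat_dotProduct_udPt_eq` (`…LocatedRowsCeiling`). -/
/-! ### §5e (E21⁺) ★★★★★ THE FIBRE FORM — one theorem over §5: a partial common maximiser ON THE TOP FIBRE of a nonneg `S × S` pin

`TwinPCMOnTop ι₁ ι₂ q P`: for every column set `b` some listed point `q_{j(b)}` is `P`-TOP and, among the `P`-top points (the top FIBRE, on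
which the `S × S` block value `⟨P, ·⟩` is frozen), maximises every twin direction `twinRow a` with `|a ∩ b| = 1`.  With the pin `λ·P`, `λ` = the
max ratio over the finitely many (row, non-top point, top point) triples, the point `j(b)` maximises the whole pinned row on the zero cells;
positivity elsewhere is automatic ⇒ junk-tolerant pattern block ⇒ ★★★★★ `sTopFibre_decided`.  SPECIAL CASES: `P = 0` is `TwinPCM` (§5c,
`twinPCMOnTop_zero`), a unique top is `sTop_decided` (§5d, `twinPCMOnTop_of_unique`); NEW: the top fibre may be large provided the twin
directions have partial common maximisers on it — e.g. the fibre's `U × U`-shadow minus its (frozen) `S × S`-shadow has a point that is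
entrywise maximal on the diagonal and minimal off it.  This is the kernel form of the TWIN TRANSFER: C′ on `n` points ⇐ a clique-type common
maximiser problem on the `U × U`-shadow of ONE positive-top fibre, `|U| ≈ n/2`. -/

/-- partial common maximisers of the twin directions ON THE TOP FIBRE of the pin functional `⟨flat P, ·⟩`. -/
def TwinPCMOnTop (ι₁ ι₂ : Fin k ↪ Fin n) {K : ℕ} (q : Fin (K + 1) → (Fin (n * n) → ℝ)) (P : Matrix (Fin n) (Fin n) ℝ) : Prop :=
  ∀ b : Finset (Fin k), ∃ j : Fin (K + 1), (∀ j', flat P ⬝ᵥ q j' ≤ flat P ⬝ᵥ q j) ∧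
    ∀ a : Finset (Fin k), (a ∩ b).card = 1 → ∀ j', flat P ⬝ᵥ q j' = flat P ⬝ᵥ q j → twinRow ι₁ ι₂ a ⬝ᵥ q j' ≤ twinRow ι₁ ι₂ a ⬝ᵥ q j

/-- `flat 0 = 0`. -/
theorem flat_zero₄₁ : flat (0 : Matrix (Fin n) (Fin n) ℝ) = 0 := by
  funext p; rfl

/-- `P = 0`: the top fibre is everything and `TwinPCMOnTop` is `TwinPCM` (§5c). -/
theorem twinPCMOnTop_zero (ι₁ ι₂ : Fin k ↪ Fin n) {K : ℕ} (q : Fin (K + 1) → (Fin (n * n) → ℝ)) (hq : TwinPCM ι₁ ι₂ q) :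
    TwinPCMOnTop ι₁ ι₂ q 0 := by
  intro b
  obtain ⟨j, hj⟩ := hq b
  refine ⟨j, fun j' => by rw [flat_zero₄₁, zero_dotProduct, zero_dotProduct], fun a hab j' _ => hj a hab j'⟩

/-- a unique top: the fibre is the single point (§5d). -/
theorem twinPCMOnTop_of_unique (ι₁ ι₂ : Fin k ↪ Fin n) {K : ℕ} (q : Fin (K + 1) → (Fin (n * n) → ℝ)) (P : Matrix (Fin n) (Fin n) ℝ)
    (js : Fin (K + 1)) (htop : ∀ j, j ≠ js → flat P ⬝ᵥ q j < flat P ⬝ᵥ q js) : TwinPCMOnTop ι₁ ι₂ q P := by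
  intro b
  refine ⟨js, fun j' => ?_, fun a _ j' hj' => ?_⟩
  · by_cases h : j' = js
    · rw [h]
    · exact le_of_lt (htop j' h)
  · by_cases h : j' = js
    · rw [h]
    · exact absurd hj' (ne_of_lt (htop j' h))

/-- ★★★ THE PINNED TWIN PATTERN BLOCK (fibre form, junk-tolerant). -/
theorem pin_twin_pattern_block (ι₁ ι₂ : Fin k ↪ Fin n) (hι : ∀ i j, ι₁ i ≠ ι₂ j) {K r : ℕ} (q : Fin (K + 1) → (Fin (n * n) → ℝ))
    (P : Matrix (Fin n) (Fin n) ℝ) (hP0 : ∀ x y, 0 ≤ P x y)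
    (hPS : ∀ x y, P x y ≠ 0 → x ∈ (Finset.univ : Finset (Fin k)).map ι₂ ∧ y ∈ (Finset.univ : Finset (Fin k)).map ι₂)
    (hq : TwinPCMOnTop ι₁ ι₂ q P) {z₁ z₂ : Fin k} (hz : z₁ ≠ z₂)
    (mrow : exactTilted.A n → ℝ) (hm1 : ∀ a j, exactTilted.ρ n a ⬝ᵥ q j ≤ mrow a)
    (hm2 : ∀ a, ∃ j, exactTilted.ρ n a ⬝ᵥ q j = mrow a)
    (U : exactTilted.A n → Option (Fin r) → ℝ) (V : Finset (Fin n) × Fin (K + 1) → Option (Fin r) → ℝ)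
    (hU : ∀ a i, 0 ≤ U a i) (hV : ∀ p i, 0 ≤ V p i)
    (hfac : ∀ a b j, (exactTilted.β n a + mrow a) - exactTilted.ρ n a ⬝ᵥ (udPt b + q j) = ∑ i, U a i * V (b, j) i) :
    3 ^ (k - 2) ≤ (r + 1) * 2 ^ (k - 2) := by
  classical
  set S := (Finset.univ : Finset (Fin k)).map ι₂ with hSdef
  set α : Finset (Fin k) := (Finset.univ.erase z₁).erase z₂ with hαdef
  have hz₂ : z₂ ∈ Finset.univ.erase z₁ := Finset.mem_erase.mpr ⟨hz.symm, Finset.mem_univ _⟩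
  have hαcard : α.card = k - 2 := by
    rw [hαdef, Finset.card_erase_of_mem hz₂, Finset.card_erase_of_mem (Finset.mem_univ _), Finset.card_univ, Fintype.card_fin]
    omega
  have hαmem : ∀ x ∈ α, x ≠ z₁ ∧ x ≠ z₂ := fun x hx => by
    simp only [hαdef, Finset.mem_erase] at hx
    exact ⟨hx.2.1, hx.1⟩
  have hz₁e : ∀ s : Finset ↥α, z₁ ∉ embα α s := fun s h => (hαmem _ (mem_of_mem_embα h)).1 rfl
  have hz₂e : ∀ s : Finset ↥α, z₂ ∉ embα α s := fun s h => (hαmem _ (mem_of_mem_embα h)).2 rfl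
  let full : Finset ↥α → Finset (Fin k) := fun a' => insert z₁ (insert z₂ (embα α a'))
  have hfull_card : ∀ a', (full a').card = a'.card + 2 := fun a' => by
    have h1 : z₁ ∉ insert z₂ (embα α a') := fun h => by
      rcases Finset.mem_insert.mp h with h | h
      · exact hz h
      · exact hz₁e a' h
    show (insert z₁ (insert z₂ (embα α a'))).card = _
    rw [Finset.card_insert_of_notMem h1, Finset.card_insert_of_notMem (hz₂e a'), card_embα]
  have hfull_inter : ∀ a' b' : Finset ↥α, full a' ∩ embα α b' = embα α (a' ∩ b') := fun a' b' => by
    show insert z₁ (insert z₂ (embα α a')) ∩ embα α b' = _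
    rw [Finset.insert_inter_of_notMem (hz₁e b'), Finset.insert_inter_of_notMem (hz₂e b'), embα_inter]
  -- the pin strength λ: dominates every (row, lower point, higher point) ratio
  let num : Finset ↥α → Fin (K + 1) → Fin (K + 1) → ℝ := fun a' j j'' => twinRow ι₁ ι₂ (full a') ⬝ᵥ (q j - q j'')
  let gap : Fin (K + 1) → Fin (K + 1) → ℝ := fun j j'' => flat P ⬝ᵥ q j'' - flat P ⬝ᵥ q j
  obtain ⟨lam, hlam0, hlam⟩ : ∃ lam : ℝ, 0 ≤ lam ∧ ∀ a' j j'', 0 < gap j j'' → num a' j j'' ≤ lam * gap j j'' := by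
    have hne : (Finset.univ : Finset (Finset ↥α × Fin (K + 1) × Fin (K + 1))).Nonempty := Finset.univ_nonempty
    let f : Finset ↥α × Fin (K + 1) × Fin (K + 1) → ℝ := fun p => max 0 (num p.1 p.2.1 p.2.2 / gap p.2.1 p.2.2)
    refine ⟨Finset.univ.sup' hne f, ?_, ?_⟩
    · exact le_trans (le_max_left 0 (num ∅ 0 0 / gap 0 0))
        (Finset.le_sup' f (Finset.mem_univ ((∅ : Finset ↥α), (0 : Fin (K + 1)), (0 : Fin (K + 1)))))
    · intro a' j j'' hg
      have h1 : num a' j j'' / gap j j'' ≤ Finset.univ.sup' hne f :=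
        le_trans (le_max_right 0 (num a' j j'' / gap j j'')) (Finset.le_sup' f (Finset.mem_univ (a', j, j'')))
      rwa [div_le_iff₀ hg] at h1
  -- rows, columns, fibre maximisers
  let row : Finset ↥α → exactTilted.A n := fun a' => ((full a').map ι₁, -udMat ((full a').map ι₂) + lam • P)
  let colset : Finset ↥α → Finset (Fin n) := fun b' => (embα α b').map ι₁ ∪ S
  have hρ : ∀ a', exactTilted.ρ n (row a') = twinRow ι₁ ι₂ (full a') + lam • flat P := fun a' => by
    show udRow ((full a').map ι₁) + flat (-udMat ((full a').map ι₂) + lam • P)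
      = udRow ((full a').map ι₁) - flat (udMat ((full a').map ι₂)) + lam • flat P
    rw [flat_add', flat_neg₄₁, flat_smul']
    abel
  have hβ : ∀ a', exactTilted.β n (row a') = 1 + hCOR (-udMat ((full a').map ι₂) + lam • P) := fun _ => rfl
  unfold TwinPCMOnTop at hq
  choose jc hjc using hq
  -- on a zero cell the fibre maximiser maximises the whole pinned row
  have hmaxrow : ∀ a' b' : Finset ↥α, (full a' ∩ embα α b').card = 1 →
      ∀ j, exactTilted.ρ n (row a') ⬝ᵥ q j ≤ exactTilted.ρ n (row a') ⬝ᵥ q (jc (embα α b')) := by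
    intro a' b' h1 j
    have htop := (hjc (embα α b')).1 j
    rw [hρ, add_dotProduct, add_dotProduct, smul_dotProduct, smul_dotProduct, smul_eq_mul, smul_eq_mul]
    by_cases hlt : flat P ⬝ᵥ q j < flat P ⬝ᵥ q (jc (embα α b'))
    · have h := hlam a' j (jc (embα α b')) (by simp only [gap]; linarith)
      simp only [num, gap, dotProduct_sub] at h
      rw [mul_sub] at h
      linarith
    · have heq : flat P ⬝ᵥ q j = flat P ⬝ᵥ q (jc (embα α b')) := le_antisymm htop (not_lt.mp hlt)
      have hfib := (hjc (embα α b')).2 (full a') h1 j heq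
      rw [heq]
      linarith
  -- the COR part of the located slack on the block is pure
  have hcor : ∀ a' b' : Finset ↥α, exactTilted.β n (row a') - exactTilted.ρ n (row a') ⬝ᵥ udPt (colset b')
      = (1 - ((a' ∩ b').card : ℝ)) ^ 2 := fun a' b' => by
    have hi1 : (full a').map ι₁ ∩ colset b' = (embα α (a' ∩ b')).map ι₁ := by
      show (full a').map ι₁ ∩ ((embα α b').map ι₁ ∪ (Finset.univ : Finset (Fin k)).map ι₂) = _
      rw [map_inter_col ι₁ ι₂ hι, hfull_inter]
    have hi2 : (full a').map ι₂ ∩ colset b' = (full a').map ι₂ := map_inter_col' ι₁ ι₂ hι _ _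
    have hPc : flat P ⬝ᵥ udPt (colset b') = flat P ⬝ᵥ udPt S :=
      flat_supported_dot_eq P S hPS (colset b') Finset.subset_union_right
    rw [hβ, hCOR_pinTilt ι₂ _ (by rw [hfull_card]; omega) P hP0 hPS hlam0, hρ, add_dotProduct, smul_dotProduct, smul_eq_mul,
      twinRow_dot_udPt, hi1, hi2, hPc, Finset.card_map, Finset.card_map, card_embα, hfull_card]
    push_cast
    ring
  have key := three_pow_le_of_pattern U V hU hV row (fun b' => (colset b', jc (embα α b'))) (fun a' b' hab => ?_) (fun a' b' hab => ?_)
  · have h1 : Fintype.card ↥α = k - 2 := by rw [Fintype.card_coe, hαcard]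
    have h2 : Fintype.card (Option (Fin r)) = r + 1 := by simp
    rw [h1, h2] at key
    exact key
  · have hfull1 : (full a' ∩ embα α b').card = 1 := by rw [hfull_inter, card_embα, hab]
    have hmax : exactTilted.ρ n (row a') ⬝ᵥ q (jc (embα α b')) = mrow (row a') := by
      apply le_antisymm (hm1 _ _)
      obtain ⟨j', hj'⟩ := hm2 (row a')
      rw [← hj']
      exact hmaxrow a' b' hfull1 j'
    rw [← hfac (row a') (colset b') (jc (embα α b')), dotProduct_add, hmax]
    have := hcor a' b'
    rw [hab] at this
    push_cast at this
    linarith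
  · have hab0 : (a' ∩ b').card = 0 := by rw [Finset.disjoint_iff_inter_eq_empty.mp hab, Finset.card_empty]
    rw [← hfac (row a') (colset b') (jc (embα α b')), dotProduct_add]
    have := hcor a' b'
    rw [hab0] at this
    push_cast at this
    have hle := hm1 (row a') (jc (embα α b'))
    linarith

/-- ★★★★★ **TOP-FIBRE PINNING DECIDES** (flat socket; contains `twinPCM_decided` (`P = 0`) and `sTop_decided` (unique top)). -/
theorem sTopFibre_decided (c₀ : ℕ) : ∃ n₀ : ℕ, ∀ n ≥ n₀, ∀ (k : ℕ) (ι₁ ι₂ : Fin k ↪ Fin n), (∀ i j, ι₁ i ≠ ι₂ j) → n ≤ 2 * k + 1 →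
    ∀ (K : ℕ) (q : Fin (K + 1) → (Fin (n * n) → ℝ)) (r : ℕ) (P : Matrix (Fin n) (Fin n) ℝ), (∀ x y, 0 ≤ P x y) →
    (∀ x y, P x y ≠ 0 → x ∈ (Finset.univ : Finset (Fin k)).map ι₂ ∧ y ∈ (Finset.univ : Finset (Fin k)).map ι₂) →
    TwinPCMOnTop ι₁ ι₂ q P → HasEFOfSize (corPolytope n + convexHull ℝ (Set.range q)) r → T c₀ n < r := by
  classical
  obtain ⟨n₀, hn₀⟩ := T_lt_of_block_wide c₀
  refine ⟨max n₀ 5, fun n hn k ι₁ ι₂ hι hnk K q r P hP0 hPS hq hR => ?_⟩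
  have hn5 : 5 ≤ n := le_of_max_le_right hn
  have hk2 : 2 ≤ k := by omega
  refine concl_of_lawBody exactTilted q (fun m hm1 hm2 U V hU hV hfac => ?_) hR
  have hz : (⟨0, by omega⟩ : Fin k) ≠ ⟨1, by omega⟩ := Fin.ne_of_val_ne (by norm_num)
  have hblock := pin_twin_pattern_block ι₁ ι₂ hι q P hP0 hPS hq hz m hm1 hm2 U V hU hV hfac
  exact hn₀ n (le_of_max_le_left hn) (k - 2) r (by omega) hblock

/-! ### §5f (E21) instances anyone can run by inspection: ONE COORDINATE with a unique maximum decides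

The single-entry pin `P = E_{xy}` (`x, y ∈ S`): `⟨flat E_{xy}, flat M⟩ = M x y`.  So: if for some near-half `S` some coordinate `(x, y) ∈ S × S`
attains its maximum over the passenger's listed matrices at a UNIQUE listed matrix, the passenger is decided (`coordTop_decided`).  An enemy's
vertex list has EVERY coordinate maximum TIED (take `S ∋ x, y`; every pair of points lies in some near-half `S`). -/

/-- the single-entry matrix. -/
def E₁ (x y : Fin n) : Matrix (Fin n) (Fin n) ℝ := fun i m => if i = x ∧ m = y then 1 else 0

/-- `⟨flat (E₁ x y), flat M⟩ = M x y`. -/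
theorem flat_E₁_dot_flat (x y : Fin n) (M : Matrix (Fin n) (Fin n) ℝ) : flat (E₁ x y) ⬝ᵥ flat M = M x y := by
  rw [flat_dotProduct_flat]
  simp only [E₁]
  rw [Finset.sum_eq_single x, Finset.sum_eq_single y]
  · simp
  · intro m _ hm; simp [hm]
  · intro h; exact absurd (Finset.mem_univ _) h
  · intro i _ hi
    apply Finset.sum_eq_zero; intro m _; simp [hi]
  · intro h; exact absurd (Finset.mem_univ _) h

/-- ★★★★ **ONE COORDINATE WITH A UNIQUE MAXIMUM DECIDES** (flat socket, matrix-listed passenger). -/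
theorem coordTop_decided (c₀ : ℕ) : ∃ n₀ : ℕ, ∀ n ≥ n₀, ∀ (k : ℕ) (ι₁ ι₂ : Fin k ↪ Fin n), (∀ i j, ι₁ i ≠ ι₂ j) → n ≤ 2 * k + 1 →
    ∀ (K : ℕ) (Qm : Fin (K + 1) → Matrix (Fin n) (Fin n) ℝ) (r : ℕ) (x y : Fin n),
    x ∈ (Finset.univ : Finset (Fin k)).map ι₂ → y ∈ (Finset.univ : Finset (Fin k)).map ι₂ →
    ∀ js : Fin (K + 1), (∀ j, j ≠ js → Qm j x y < Qm js x y) →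
    HasEFOfSize (corPolytope n + convexHull ℝ (Set.range fun j => flat (Qm j))) r → T c₀ n < r := by
  classical
  obtain ⟨n₀, hn₀⟩ := sTop_decided c₀
  refine ⟨n₀, fun n hn k ι₁ ι₂ hι hnk K Qm r x y hx hy js htop hR => ?_⟩
  refine hn₀ n hn k ι₁ ι₂ hι hnk K (fun j => flat (Qm j)) r (E₁ x y) (fun i m => by
    simp only [E₁]; split_ifs <;> norm_num) (fun i m him => ?_) js (fun j hj => ?_) hR
  · simp only [E₁, ne_eq, ite_eq_right_iff, one_ne_zero, imp_false, not_not] at him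
    rw [him.1, him.2]; exact ⟨hx, hy⟩
  · rw [flat_E₁_dot_flat, flat_E₁_dot_flat]; exact htop j hj

end Part6

end Summit.ValiantsHypothesis.ValiantsHypothesis.Theorems.FifoMatching.ShadowConstRead
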